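import Summits.Parity.GeneralizedHardyLittlewood.Theorems.GreenTaoLevelTwoMNTwoVerticalComponents
import Mathlib.MeasureTheory.Integral.Pi
import Mathlib.MeasureTheory.Integral.IntervalIntegral.Periodic
import Mathlib.Analysis.SpecialFunctions.Integrals.Basic
import HarnessLib

/-!
# Route `GreenTaoLevelTwo`, crux `MNTwo` (stmt-Parity-21276), line `birth`: decay of the
# smoothing multiplier (the harmonic-analysis core of `stub_verticalReduction`, III)

The box smoothing at scale `s` along a central frame multiplies the `n`-th vertical Fourier
component by `φ_n(s) = ∫_{(ℝ/ℤ)^I} e_n(π(s σ̃)) dσ` (`…MNTwoVerticalSmoothing.vComp_smooth`).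
Here: `φ_n(s) = ∏ᵢ ψ(nᵢ s)` with `ψ(a) = ∫₀¹ e(a v) dv` (Fubini over the product Haar measure and
transfer of the Haar integral on `ℝ/ℤ` to `(0,1)`), and the decay
`|ψ(a)| ≤ 1`, `|ψ(a)| · π|a| ≤ 1` (geometric-sum / `∫ e^{cv} = (e^{c}-1)/c`), whence
`|φ_n(s)| ≤ ∏ᵢ bᵢ` with `bᵢ = 1` if `nᵢ = 0` and `bᵢ = min(1, (π |s| |nᵢ|)⁻¹)` otherwise
(`norm_smoothMultiplier_le_prod`).  Squared (two smoothings) these weights are summable over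
`ℤ^I` with polynomial tails — the input of the truncation step.

References: B. Green, T. Tao, *The Möbius function is strongly orthogonal to nilsequences*,
Ann. of Math. 175 (2012), Lemma 3.7 and App. A [GreenTao2012Mobius].
-/

noncomputable section

open MeasureTheory
open Literature.NumberTheory.Sieve
open Summit.Parity.GeneralizedHardyLittlewood.GreenTaoLevelTwoMNTwoVerticalComponents

namespace Summit.Parity.GeneralizedHardyLittlewood.GreenTaoLevelTwoMNTwoVerticalMultiplier

variable {I : Type}

/-! ### §1 One coordinate: `ψ(a) = ∫₀¹ e(a v) dv` -/

/-- Transfer of the normalised Haar integral on `ℝ/ℤ` of `c ↦ e(k · r c̃)` (`c̃ ∈ [0,1)` the lift)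
to the interval: `∫ e(k r c̃) dc = ∫₀¹ exp(2πi k r v) dv`. [folklore] -/
theorem integral_fourier_lift (k : ℤ) (r : ℝ) :
    ∫ c : UnitAddCircle, (fourier k (((r * (AddCircle.equivIco (1 : ℝ) 0 c : ℝ) : ℝ)) : UnitAddCircle) : ℂ)
        ∂AddCircle.haarAddCircle =
      ∫ v in (0 : ℝ)..1, Complex.exp (2 * Real.pi * Complex.I * k * (r * v)) := by
  rw [AddCircle.integral_haarAddCircle, inv_one, one_smul, ← UnitAddCircle.integral_preimage 0,
    intervalIntegral.integral_of_le zero_le_one]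
  simp only [zero_add]
  -- replace `Ioc` by `Ioo` (a null set apart) and evaluate the lift there
  rw [setIntegral_congr_set (Ioo_ae_eq_Ioc (μ := (volume : Measure ℝ)) (a := (0 : ℝ)) (b := 1)).symm,
    setIntegral_congr_set (Ioo_ae_eq_Ioc (μ := (volume : Measure ℝ)) (a := (0 : ℝ)) (b := 1)).symm]
  refine setIntegral_congr_fun measurableSet_Ioo fun v hv => ?_
  have hv' : v ∈ Set.Ico (0 : ℝ) (0 + 1) := by
    rw [zero_add]; exact ⟨hv.1.le, hv.2⟩
  rw [AddCircle.equivIco_coe_of_mem hv', fourier_coe_apply]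
  congr 1
  push_cast
  ring

/-- `|∫₀¹ exp(2πi k r v) dv| ≤ 1`. [folklore] -/
theorem norm_integral_exp_le_one (k : ℤ) (r : ℝ) :
    ‖∫ v in (0 : ℝ)..1, Complex.exp (2 * Real.pi * Complex.I * k * (r * v))‖ ≤ 1 := by
  have h := intervalIntegral.norm_integral_le_of_norm_le_const (a := (0 : ℝ)) (b := 1) (C := 1)
    (f := fun v : ℝ => Complex.exp (2 * Real.pi * Complex.I * k * (r * v))) fun v _ => by
      have : (2 * Real.pi * Complex.I * k * (r * v) : ℂ) = ((2 * Real.pi * k * (r * v) : ℝ) : ℂ) * Complex.I := by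
        push_cast; ring
      rw [this, Complex.norm_exp_ofReal_mul_I]
  simpa using h

/-- **Decay**: `|∫₀¹ exp(2πi k r v) dv| · (π |k| |r|) ≤ 1` (for `k r ≠ 0` the integral is
`(e(kr) − 1)/(2πi k r)`; for `k r = 0` the left side vanishes). [folklore] -/
theorem norm_integral_exp_mul_le_one (k : ℤ) (r : ℝ) :
    ‖∫ v in (0 : ℝ)..1, Complex.exp (2 * Real.pi * Complex.I * k * (r * v))‖ * (Real.pi * |(k : ℝ)| * |r|) ≤ 1 := by
  by_cases hkr : (k : ℝ) * r = 0
  · have : Real.pi * |(k : ℝ)| * |r| = 0 := by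
      rw [mul_assoc, ← abs_mul, hkr, abs_zero, mul_zero]
    rw [this, mul_zero]; exact zero_le_one
  · set c : ℂ := 2 * Real.pi * Complex.I * k * r with hc
    have hc0 : c ≠ 0 := by
      rw [hc]
      have h2 : (2 * Real.pi : ℂ) ≠ 0 := by exact_mod_cast (by positivity : (2 * Real.pi : ℝ) ≠ 0)
      have hkr' : ((k : ℝ) : ℂ) * (r : ℂ) ≠ 0 := by exact_mod_cast hkr
      have : (2 * Real.pi * Complex.I * k * r : ℂ) = (2 * Real.pi) * Complex.I * ((k : ℝ) * r : ℂ) := by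
        push_cast; ring
      rw [this]
      exact mul_ne_zero (mul_ne_zero h2 Complex.I_ne_zero) hkr'
    have e : (fun v : ℝ => Complex.exp (2 * Real.pi * Complex.I * k * (r * v))) =
        fun v : ℝ => Complex.exp (c * v) := by
      funext v; rw [hc]; ring_nf
    rw [e, integral_exp_mul_complex hc0]
    -- `‖(e^{c} - e^{0}) / c‖ ≤ 2 / ‖c‖ = 1 / (π |k| |r|)`
    have hnc : ‖c‖ = 2 * Real.pi * |(k : ℝ)| * |r| := by
      rw [hc]
      have : (2 * Real.pi * Complex.I * k * r : ℂ) = ((2 * Real.pi * (k * r) : ℝ) : ℂ) * Complex.I := by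
        push_cast; ring
      rw [this, norm_mul, Complex.norm_I, mul_one, Complex.norm_real, Real.norm_eq_abs, abs_mul,
        abs_of_pos (by positivity : (0 : ℝ) < 2 * Real.pi), abs_mul]
      ring
    have hnum : ‖Complex.exp (c * (1 : ℝ)) - Complex.exp (c * (0 : ℝ))‖ ≤ 2 := by
      refine (norm_sub_le _ _).trans ?_
      have h1 : ‖Complex.exp (c * (1 : ℝ))‖ = 1 := by
        rw [hc]
        have : (2 * Real.pi * Complex.I * k * r * ((1 : ℝ) : ℂ) : ℂ) = ((2 * Real.pi * (k * r) : ℝ) : ℂ) * Complex.I := by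
          push_cast; ring
        rw [this, Complex.norm_exp_ofReal_mul_I]
      have h0 : ‖Complex.exp (c * (0 : ℝ))‖ = 1 := by simp
      rw [h1, h0]; norm_num
    have hcpos : 0 < ‖c‖ := norm_pos_iff.mpr hc0
    rw [norm_div, div_mul_eq_mul_div, div_le_one hcpos, hnc]
    nlinarith [hnum, Real.pi_pos, abs_nonneg (k : ℝ), abs_nonneg r,
      mul_nonneg (mul_nonneg Real.pi_pos.le (abs_nonneg (k : ℝ))) (abs_nonneg r)]

/-- The one-coordinate weight (`r ≠ 0`): `|ψ(k r)| ≤ b(k)`, `b(k) = 1` for `k = 0` and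
`min(1, (π |r| |k|)⁻¹)` otherwise. [folklore] -/
theorem norm_integral_exp_le_weight (k : ℤ) {r : ℝ} (hr : r ≠ 0) :
    ‖∫ v in (0 : ℝ)..1, Complex.exp (2 * Real.pi * Complex.I * k * (r * v))‖ ≤
      (if k = 0 then (1 : ℝ) else min 1 (1 / (Real.pi * |r| * |(k : ℝ)|))) := by
  split_ifs with hk
  · exact norm_integral_exp_le_one k r
  · refine le_min (norm_integral_exp_le_one k r) ?_
    have hk' : (k : ℝ) ≠ 0 := by exact_mod_cast hk
    have hpos : 0 < Real.pi * |(k : ℝ)| * |r| := by positivity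
    rw [show Real.pi * |r| * |(k : ℝ)| = Real.pi * |(k : ℝ)| * |r| by ring, le_div_iff₀ hpos]
    exact norm_integral_exp_mul_le_one k r

/-! ### §2 The multiplier is a product over coordinates -/

/-- **`φ_n(s) = ∏ᵢ ψ(nᵢ s)`**: the smoothing multiplier factorises over the coordinates of the
torus (Fubini for the product Haar measure). [folklore] -/
theorem smoothMultiplier_eq_prod [Fintype I] (n : I → ℤ) (r : ℝ) :
    ∫ σ : UnitAddTorus I, UnitAddTorus.mFourier n
        (fun i => (((r * (AddCircle.equivIco (1 : ℝ) 0 (σ i) : ℝ) : ℝ)) : UnitAddCircle))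
        ∂(Measure.pi fun _ : I => AddCircle.haarAddCircle) =
      ∏ i, ∫ v in (0 : ℝ)..1, Complex.exp (2 * Real.pi * Complex.I * (n i) * (r * v)) := by
  have e : (fun σ : UnitAddTorus I => UnitAddTorus.mFourier n
      (fun i => (((r * (AddCircle.equivIco (1 : ℝ) 0 (σ i) : ℝ) : ℝ)) : UnitAddCircle))) =
      fun σ => ∏ i, (fun (i : I) (c : UnitAddCircle) =>
        (fourier (n i) (((r * (AddCircle.equivIco (1 : ℝ) 0 c : ℝ) : ℝ)) : UnitAddCircle) : ℂ)) i (σ i) := by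
    funext σ
    simp only [UnitAddTorus.mFourier, ContinuousMap.coe_mk]
  have h := MeasureTheory.integral_fintype_prod_eq_prod (𝕜 := ℂ)
    (μ := fun _ : I => (AddCircle.haarAddCircle : Measure UnitAddCircle))
    (fun (i : I) (c : UnitAddCircle) =>
      (fourier (n i) (((r * (AddCircle.equivIco (1 : ℝ) 0 c : ℝ) : ℝ)) : UnitAddCircle) : ℂ))
  rw [e]
  exact h.trans (Finset.prod_congr rfl fun i _ => integral_fourier_lift (n i) r)

/-- **Decay of the smoothing multiplier**: `|φ_n(s)| ≤ ∏ᵢ bᵢ`, `bᵢ = 1` if `nᵢ = 0`,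
`bᵢ = min(1, (π |s| |nᵢ|)⁻¹)` otherwise (`s ≠ 0`). [cite: GreenTao2012Mobius, Lemma 3.7 and App. A] -/
theorem norm_smoothMultiplier_le_prod [Fintype I] (n : I → ℤ) {r : ℝ} (hr : r ≠ 0) :
    ‖∫ σ : UnitAddTorus I, UnitAddTorus.mFourier n
        (fun i => (((r * (AddCircle.equivIco (1 : ℝ) 0 (σ i) : ℝ) : ℝ)) : UnitAddCircle))
        ∂(Measure.pi fun _ : I => AddCircle.haarAddCircle)‖ ≤
      ∏ i, (if n i = 0 then (1 : ℝ) else min 1 (1 / (Real.pi * |r| * |(n i : ℝ)|))) := by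
  rw [smoothMultiplier_eq_prod, norm_prod]
  exact Finset.prod_le_prod (fun i _ => norm_nonneg _) fun i _ => norm_integral_exp_le_weight (n i) hr

end Summit.Parity.GeneralizedHardyLittlewood.GreenTaoLevelTwoMNTwoVerticalMultiplier
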